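import Summits.QuantumFields.YangMills.Theorems.DiagonalMirrorRPRWilsonDiagonalModelReweight
import Summits.QuantumFields.YangMills.Theorems.DiagonalMirrorRPRWilsonDiagonalModelInsertionPairs

/-!
# Crux `WeakCouplingHypercubicLimitRP` (stmt-QuantumFields-27398) / aside `DiagonalMirrorRPR` (stmt-QuantumFields-10604), door B,
# construction F1_diag — PAIRING LAYER, step P3a: open links, half blocks and the Gram BLOCK KERNEL of a reflected observable

Helper file (`--supports stmt-QuantumFields-27398 --as helper`) of the hand `hand-10604-wilsonDiagModel-2` (docket director-ym O4 WORD 16 (1) /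
28: P3 → P4 → A of hand-1's ROADMAP-F1diag v4 §1⅞ and hand-2's ROADMAP v5) for the registered stub D1 `stub_diagRPOfPlaneLimits` of
`Cruxes/WeakCouplingHypercubicLimitRP/Lines/Sketch.lean`; it closes nothing by itself.

WHAT.  All objects live on hand-1's FINITE reweighted measure space `(ℕ × HalfCfg, μ̃ = tMeasure S G Nc β M)` (`…Reweight`), on which the
reweighted lifted kernel `𝔟 = bKernel ρ β M` is bounded; this is the space on which the tree's spectral package produced the eigenbasis
(`…SpectralData.exists_eigenPackage`).
* §1 `openLink ρ β M a b Y` — the integrand of `𝔟(a, b)` BEFORE the bond-half-layer integration: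
  `e^{β inslab X/2} e^{β inslab X′/2} (√w_k √w_{k′})⁻¹ · ψ_k(w(ΘY)) e^{β odd(X,Y,X′)} ψ_{k′}(w(Y))`, `a = (k,X)`, `b = (k′,X′)`;
  `integral_openLink` (`∫ openLink dY = 𝔟`), `openLink_thetaHalf` (reversal `openLink a b (ΘY) = openLink b a Y`), uniform bound,
  continuity / joint measurability.
* §2 `halfBlock ρ β M f v` — for an observable `f(Y_1…Y_d, X_1…X_d)` of DEPTH `d = e+1` (a bounded measurable function of `d` bond half
  layers and `d` in-slab half layers) and lifted sites `v_0 … v_d`, the integral over the `d` bond half layers of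
  `∏_{i<d} openLink(v_i, v_{i+1})(Y_{i+1}) · f(Y, X(v_1…v_d))` — the half-observable transported from layer `0` to layer `d`;
  `halfBlockT ρ β M f v₀ x` integrates it over the interior sites `v_1 … v_{d-1}` (measure `μ̃^{d-1}`); the **block kernel**
  `blockKernel ρ β M f x y = ∫ halfBlockT v₀ x · halfBlockT v₀ y dμ̃(v₀)` is a GRAM kernel (hence positive semi-definite, file `…GramPSD`)
  and symmetric; all three are bounded and measurable.
* §3 `obsR f P` / `obsL f P` — the observable and its swap-reflection read on a pair string `P : ℤ/mℤ → HalfCfg × HalfCfg`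
  (`obsR` reads layers `1 … d`; `obsL f P = obsR f (reflectPairs P)`).

HONEST FRAMING: definitions and bookkeeping only; `wilsonDiagonalModel` is NOT landed here; no letter is proved; D1, ⟨27398⟩, S6i and the aside
⟨10604⟩ are OPEN; nothing here bears on the summit; the Yang–Mills mass gap is NOT proved here or anywhere in the tree.  No instance, no notation,
`autoImplicit false`.

References: K. Osterwalder, E. Seiler, Ann. Phys. 110 (1978) §2–3 (transfer matrix and reflection positivity for lattice gauge theories);
E. Seiler, LNP 159 (1982) Ch. 2; B. Simon, *Trace Ideals* (2005) Ch. 3.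
-/

set_option autoImplicit false

noncomputable section

open scoped BigOperators ENNReal
open MeasureTheory Function
open Literature.MathematicalPhysics.QuantumLattice Literature.MathematicalPhysics.QuantumFieldTheory
open Summit.QuantumFields.YangMills.Cruxes.DiagonalMirrorRPR.ParityBridgeColdTraces

namespace Summit.QuantumFields.YangMills.Cruxes.DiagonalMirrorRPR.SignTwistedDiagonalTrace.WilsonDiagonal

/-! ## §1 Open links -/

section OpenLink

variable {S : ℕ} [NeZero S] {G : Type} [Group G] {Nc : ℕ} (ρ : G →* Matrix (Fin Nc) (Fin Nc) ℂ)
variable [TopologicalSpace G] [IsTopologicalGroup G] [CompactSpace G] [MeasurableSpace G] [BorelSpace G]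

/-- **The open link** `openLink ρ β M (k,X) (k′,X′) Y = e^{β inslab X/2} e^{β inslab X′/2} (√w_k √w_{k′})⁻¹ · ψ_k(w(ΘY)) e^{β odd(X,Y,X′)} ψ_{k′}(w(Y))`:
the integrand of the reweighted lifted kernel `𝔟((k,X),(k′,X′))` before the integration over the bond half layer `Y` between the two
in-slab half layers (`integral_openLink`). -/
def openLink (β M : ℝ) (a b : ℕ × HalfCfg S S G) (Y : HalfCfg S S G) : ℝ :=
  Real.exp (β / 2 * inslabAction ρ a.2) * Real.exp (β / 2 * inslabAction ρ b.2) /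
      (Real.sqrt (featWeight (featDim S Nc) β M a.1) * Real.sqrt (featWeight (featDim S Nc) β M b.1)) *
    (natFeature (p := featDim S Nc) β a.1 (bondVec ρ (thetaHalf Y)) * Real.exp (β * oddActionU ρ a.2 Y b.2) *
      natFeature (p := featDim S Nc) β b.1 (bondVec ρ Y))

/-- `∫ openLink(a, b)(Y) dY = 𝔟(a, b)`. -/
theorem integral_openLink (β M : ℝ) (a b : ℕ × HalfCfg S S G) :
    ∫ Y, openLink ρ β M a b Y ∂(halfHaar S G) = bKernel ρ β M a b := by
  unfold openLink bKernel natKernel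
  rw [integral_const_mul]
  ring

omit [TopologicalSpace G] [IsTopologicalGroup G] [CompactSpace G] [MeasurableSpace G] [BorelSpace G] in
/-- **Reversal**: `openLink(a, b)(ΘY) = openLink(b, a)(Y)` (`Θ` involutive, the odd half step `Θ`-pseudo-symmetric). -/
theorem openLink_thetaHalf (β M : ℝ) (a b : ℕ × HalfCfg S S G) (Y : HalfCfg S S G) :
    openLink ρ β M a b (thetaHalf Y) = openLink ρ β M b a Y := by
  unfold openLink
  rw [thetaHalf_thetaHalf, oddActionU_reverse]
  ring

omit [CompactSpace G] [MeasurableSpace G] [BorelSpace G] in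
/-- Continuity of the half in-slab weight. -/
theorem continuous_exp_half_inslabAction (hρ : Continuous ρ) (β : ℝ) :
    Continuous fun X : HalfCfg S S G => Real.exp (β / 2 * inslabAction ρ X) := by
  refine Real.continuous_exp.comp (continuous_const.mul ?_)
  unfold inslabAction
  refine continuous_finsetSum _ fun s _ => Complex.continuous_re.comp (Continuous.matrix_trace (hρ.comp ?_))
  fun_prop

omit [CompactSpace G] [MeasurableSpace G] [BorelSpace G] in
/-- For fixed feature indices the open link is continuous in the three half layers `(X, X′, Y)`. -/
theorem continuous_openLink (hρ : Continuous ρ) (β M : ℝ) (k k' : ℕ) :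
    Continuous fun q : HalfCfg S S G × HalfCfg S S G × HalfCfg S S G => openLink ρ β M (k, q.1) (k', q.2.1) q.2.2 := by
  unfold openLink
  have hins := continuous_exp_half_inslabAction ρ hρ β (S := S)
  have h1 : Continuous fun q : HalfCfg S S G × HalfCfg S S G × HalfCfg S S G => Real.exp (β / 2 * inslabAction ρ q.1) :=
    hins.comp continuous_fst
  have h2 : Continuous fun q : HalfCfg S S G × HalfCfg S S G × HalfCfg S S G => Real.exp (β / 2 * inslabAction ρ q.2.1) :=
    hins.comp (continuous_fst.comp continuous_snd)
  have h3 : Continuous fun q : HalfCfg S S G × HalfCfg S S G × HalfCfg S S G =>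
      natFeature (p := featDim S Nc) β k (bondVec ρ (thetaHalf q.2.2)) :=
    (continuous_natFeature_bondVec ρ hρ β k).comp (continuous_thetaHalf.comp (continuous_snd.comp continuous_snd))
  have h4 : Continuous fun q : HalfCfg S S G × HalfCfg S S G × HalfCfg S S G =>
      natFeature (p := featDim S Nc) β k' (bondVec ρ q.2.2) :=
    (continuous_natFeature_bondVec ρ hρ β k').comp (continuous_snd.comp continuous_snd)
  have hsw : Continuous fun q : HalfCfg S S G × HalfCfg S S G × HalfCfg S S G => (q.1, q.2.2, q.2.1) :=
    continuous_fst.prodMk ((continuous_snd.comp continuous_snd).prodMk (continuous_fst.comp continuous_snd))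
  have h5' : Continuous fun q : HalfCfg S S G × HalfCfg S S G × HalfCfg S S G => oddActionU ρ q.1 q.2.2 q.2.1 := by
    have h := (continuous_oddActionU (S := S) ρ hρ).comp hsw
    simpa only [Function.comp_def] using h
  have h5 : Continuous fun q : HalfCfg S S G × HalfCfg S S G × HalfCfg S S G =>
      Real.exp (β * oddActionU ρ q.1 q.2.2 q.2.1) :=
    Real.continuous_exp.comp (continuous_const.mul h5')
  have h12 : Continuous fun q : HalfCfg S S G × HalfCfg S S G × HalfCfg S S G =>
      Real.exp (β / 2 * inslabAction ρ q.1) * Real.exp (β / 2 * inslabAction ρ q.2.1) /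
        (Real.sqrt (featWeight (featDim S Nc) β M k) * Real.sqrt (featWeight (featDim S Nc) β M k')) :=
    (h1.mul h2).div_const _
  exact h12.mul ((h3.mul h5).mul h4)

variable [SecondCountableTopology G]

omit [CompactSpace G] in
/-- The open link is jointly measurable in `(a, b, Y)` (countable discrete factors, continuity in the continuous ones). -/
theorem measurable_openLink (hρ : Continuous ρ) (β M : ℝ) :
    Measurable fun q : (ℕ × HalfCfg S S G) × (ℕ × HalfCfg S S G) × HalfCfg S S G => openLink ρ β M q.1 q.2.1 q.2.2 := by
  have hg : Measurable fun q : (HalfCfg S S G × HalfCfg S S G × HalfCfg S S G) × (ℕ × ℕ) =>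
      openLink ρ β M (q.2.1, q.1.1) (q.2.2, q.1.2.1) q.1.2.2 := by
    refine measurable_from_prod_countable_left fun kk' => ?_
    exact (continuous_openLink ρ hρ β M kk'.1 kk'.2).measurable
  have he : Measurable fun q : (ℕ × HalfCfg S S G) × (ℕ × HalfCfg S S G) × HalfCfg S S G =>
      ((q.1.2, q.2.1.2, q.2.2), (q.1.1, q.2.1.1)) :=
    (measurable_fst.snd.prodMk (measurable_snd.fst.snd.prodMk measurable_snd.snd)).prodMk
      (measurable_fst.fst.prodMk measurable_snd.fst.fst)
  simpa only [Function.comp_def] using hg.comp he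

omit [MeasurableSpace G] [BorelSpace G] [SecondCountableTopology G] in
/-- **Uniform bound**: `|openLink| ≤ C` once `|w(Y)_j| ≤ M` (the two features are dominated by `√w_k`, `√w_{k′}`). -/
theorem exists_abs_openLink_le (hρ : Continuous ρ) (β : ℝ) {M : ℝ}
    (hM : ∀ (Y : HalfCfg S S G) (j : Fin (featDim S Nc)), |bondVec ρ Y j| ≤ M) :
    ∃ C : ℝ, 0 < C ∧ ∀ (a b : ℕ × HalfCfg S S G) (Y : HalfCfg S S G), |openLink ρ β M a b Y| ≤ C := by
  obtain ⟨Co, hCo, hodd⟩ := exists_exp_oddActionU_le (S := S) ρ hρ β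
  obtain ⟨Ci, hCi, hins⟩ := exists_exp_inslabAction_le (S := S) ρ hρ β
  refine ⟨Ci * Ci * Co, by positivity, fun a b Y => ?_⟩
  have hwa := featWeight_pos (featDim S Nc) β M a.1
  have hwb := featWeight_pos (featDim S Nc) β M b.1
  have hsa := Real.sqrt_pos.2 hwa
  have hsb := Real.sqrt_pos.2 hwb
  have hψa : |natFeature (p := featDim S Nc) β a.1 (bondVec ρ (thetaHalf Y))| ≤ Real.sqrt (featWeight (featDim S Nc) β M a.1) :=
    abs_natFeature_le_sqrt_featWeight β a.1 fun j => hM _ j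
  have hψb : |natFeature (p := featDim S Nc) β b.1 (bondVec ρ Y)| ≤ Real.sqrt (featWeight (featDim S Nc) β M b.1) :=
    abs_natFeature_le_sqrt_featWeight β b.1 fun j => hM _ j
  unfold openLink
  rw [abs_mul, abs_div, abs_mul, abs_mul, abs_mul, abs_mul, abs_of_pos (Real.exp_pos _), abs_of_pos (Real.exp_pos _),
    abs_of_pos (Real.exp_pos _), abs_of_pos hsa, abs_of_pos hsb, div_mul_eq_mul_div, div_le_iff₀ (mul_pos hsa hsb)]
  calc Real.exp (β / 2 * inslabAction ρ a.2) * Real.exp (β / 2 * inslabAction ρ b.2) *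
        (|natFeature (p := featDim S Nc) β a.1 (bondVec ρ (thetaHalf Y))| * Real.exp (β * oddActionU ρ a.2 Y b.2) *
          |natFeature (p := featDim S Nc) β b.1 (bondVec ρ Y)|)
      ≤ Ci * Ci * (Real.sqrt (featWeight (featDim S Nc) β M a.1) * Co * Real.sqrt (featWeight (featDim S Nc) β M b.1)) := by
        refine mul_le_mul (mul_le_mul (hins _) (hins _) (Real.exp_pos _).le hCi.le) ?_ (by positivity) (by positivity)
        exact mul_le_mul (mul_le_mul hψa (hodd _ _ _) (Real.exp_pos _).le (Real.sqrt_nonneg _)) hψb (abs_nonneg _)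
          (by positivity)
    _ = Ci * Ci * Co * (Real.sqrt (featWeight (featDim S Nc) β M a.1) * Real.sqrt (featWeight (featDim S Nc) β M b.1)) := by
        ring

end OpenLink

/-! ## §2 Half blocks and the block kernel of an observable of depth `d = e + 1` -/

section Block

variable {S : ℕ} [NeZero S] {G : Type} [Group G] {Nc : ℕ} (ρ : G →* Matrix (Fin Nc) (Fin Nc) ℂ)
variable [TopologicalSpace G] [IsTopologicalGroup G] [CompactSpace G] [MeasurableSpace G] [BorelSpace G]

/-- **The half block** of an observable `f(Y_1…Y_d, X_1…X_d)` of depth `d = e+1` at the lifted sites `v_0, …, v_d` (`v_j = (k_j, X_j)`):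
`∫ ∏_{i<d} openLink(v_i, v_{i+1})(Y_{i+1}) · f(Y_1…Y_d, X_1…X_d) dY_1⋯dY_d` — the half-observable transported across its `d` layers
(for `f ≡ 1` it is `∏_i 𝔟(v_i, v_{i+1})`). -/
def halfBlock (β M : ℝ) {e : ℕ} (f : (Fin (e + 1) → HalfCfg S S G) → (Fin (e + 1) → HalfCfg S S G) → ℝ)
    (v : Fin (e + 2) → ℕ × HalfCfg S S G) : ℝ :=
  ∫ Y : Fin (e + 1) → HalfCfg S S G, (∏ i : Fin (e + 1), openLink ρ β M (v (Fin.castSucc i)) (v i.succ) (Y i)) *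
      f Y (fun i => (v i.succ).2) ∂(Measure.pi fun _ => halfHaar S G)

variable [SecondCountableTopology G]

variable (S G Nc) in
/-- **The half block integrated over its interior sites**: `halfBlockT v₀ x = ∫ halfBlock (v₀, u_1, …, u_{d-1}, x) dμ̃^{d-1}(u)` — the kernel of
the operator `𝒯_f` transporting the half-observable from the reflection layer `0` (site `v₀`) to the block boundary (site `x`). -/
def halfBlockT (β M : ℝ) {e : ℕ} (f : (Fin (e + 1) → HalfCfg S S G) → (Fin (e + 1) → HalfCfg S S G) → ℝ)
    (v₀ x : ℕ × HalfCfg S S G) : ℝ :=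
  ∫ U : Fin e → ℕ × HalfCfg S S G, halfBlock ρ β M f (Fin.cons v₀ (Fin.snoc U x)) ∂(Measure.pi fun _ => tMeasure S G Nc β M)

variable (S G Nc) in
/-- **The block kernel** of the observable `f`: the Gram kernel `blockKernel x y = ∫ halfBlockT(v₀, x) · halfBlockT(v₀, y) dμ̃(v₀)` (`𝒲_f = 𝒯_f† 𝒯_f`)
— the kernel between the two boundary sites `x = v_{-d}`, `y = v_d` of the reflection-symmetric block of `2d` layers carrying `Θf · f`. -/
def blockKernel (β M : ℝ) {e : ℕ} (f : (Fin (e + 1) → HalfCfg S S G) → (Fin (e + 1) → HalfCfg S S G) → ℝ)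
    (x y : ℕ × HalfCfg S S G) : ℝ :=
  ∫ v₀, halfBlockT S G Nc ρ β M f v₀ x * halfBlockT S G Nc ρ β M f v₀ y ∂(tMeasure S G Nc β M)

omit [CompactSpace G] in
/-- The half-block integrand is jointly measurable in (sites, bond half layers) for a measurable observable. -/
theorem measurable_halfBlock_integrand (hρ : Continuous ρ) (β M : ℝ) {e : ℕ}
    {f : (Fin (e + 1) → HalfCfg S S G) → (Fin (e + 1) → HalfCfg S S G) → ℝ} (hf : Measurable (uncurry f)) :
    Measurable fun q : (Fin (e + 2) → ℕ × HalfCfg S S G) × (Fin (e + 1) → HalfCfg S S G) =>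
      (∏ i : Fin (e + 1), openLink ρ β M (q.1 (Fin.castSucc i)) (q.1 i.succ) (q.2 i)) * f q.2 (fun i => (q.1 i.succ).2) := by
  refine (Finset.measurable_prod _ fun i _ => ?_).mul ?_
  · have h := (measurable_openLink (S := S) ρ hρ β M).comp
      (((measurable_pi_apply (Fin.castSucc i)).comp measurable_fst).prodMk
        (((measurable_pi_apply i.succ).comp measurable_fst).prodMk ((measurable_pi_apply i).comp measurable_snd)) :
        Measurable fun q : (Fin (e + 2) → ℕ × HalfCfg S S G) × (Fin (e + 1) → HalfCfg S S G) =>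
          (q.1 (Fin.castSucc i), q.1 i.succ, q.2 i))
    simpa only [Function.comp_def] using h
  · have h := hf.comp (measurable_snd.prodMk (measurable_pi_lambda _ fun i =>
      measurable_snd.comp ((measurable_pi_apply i.succ).comp measurable_fst)) :
        Measurable fun q : (Fin (e + 2) → ℕ × HalfCfg S S G) × (Fin (e + 1) → HalfCfg S S G) =>
          (q.2, fun i => (q.1 i.succ).2))
    simpa only [Function.comp_def, uncurry] using h

/-- The half block is a measurable function of its sites. -/
theorem measurable_halfBlock (hρ : Continuous ρ) (β M : ℝ) {e : ℕ}
    {f : (Fin (e + 1) → HalfCfg S S G) → (Fin (e + 1) → HalfCfg S S G) → ℝ} (hf : Measurable (uncurry f)) :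
    Measurable (halfBlock ρ β M f) := by
  haveI : SigmaFinite (halfHaar S G) := by unfold halfHaar; infer_instance
  have h := (measurable_halfBlock_integrand ρ hρ β M hf).stronglyMeasurable.integral_prod_right'
    (ν := Measure.pi fun _ : Fin (e + 1) => halfHaar S G)
  have h' := h.measurable
  unfold halfBlock
  simpa only using h'

omit [SecondCountableTopology G] in
/-- **The half block is bounded**: `|halfBlock f v| ≤ C^{d} B` when `|openLink| ≤ C` and `|f| ≤ B` (probability measure). -/
theorem abs_halfBlock_le (β M : ℝ) {e : ℕ} {f : (Fin (e + 1) → HalfCfg S S G) → (Fin (e + 1) → HalfCfg S S G) → ℝ}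
    {C B : ℝ} (hC0 : 0 ≤ C) (hC : ∀ (a b : ℕ × HalfCfg S S G) (Y : HalfCfg S S G), |openLink ρ β M a b Y| ≤ C)
    (hB : ∀ Y X, |f Y X| ≤ B) (v : Fin (e + 2) → ℕ × HalfCfg S S G) :
    |halfBlock ρ β M f v| ≤ C ^ (e + 1) * B := by
  haveI : IsProbabilityMeasure (halfHaar S G) := by unfold halfHaar; infer_instance
  unfold halfBlock
  have h := norm_integral_le_of_norm_le_const (μ := Measure.pi fun _ : Fin (e + 1) => halfHaar S G)
    (f := fun Y : Fin (e + 1) → HalfCfg S S G =>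
      (∏ i : Fin (e + 1), openLink ρ β M (v (Fin.castSucc i)) (v i.succ) (Y i)) * f Y (fun i => (v i.succ).2))
    (C := C ^ (e + 1) * B) (ae_of_all _ fun Y => ?_)
  · rwa [probReal_univ, mul_one, Real.norm_eq_abs] at h
  · rw [Real.norm_eq_abs, abs_mul, Finset.abs_prod]
    refine mul_le_mul ?_ (hB _ _) (abs_nonneg _) (by positivity)
    calc ∏ i : Fin (e + 1), |openLink ρ β M (v (Fin.castSucc i)) (v i.succ) (Y i)| ≤ ∏ _i : Fin (e + 1), C :=
          Finset.prod_le_prod (fun i _ => abs_nonneg _) fun i _ => hC _ _ _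
      _ = C ^ (e + 1) := by rw [Finset.prod_const, Finset.card_univ, Fintype.card_fin]

omit [NeZero S] [Group G] [TopologicalSpace G] [IsTopologicalGroup G] [CompactSpace G] [BorelSpace G]
  [SecondCountableTopology G] in
/-- Assembling the sites `(v₀, u_1, …, u_{d-1}, x)` is measurable in `((v₀, x), u)`. -/
theorem measurable_cons_snoc {e : ℕ} :
    Measurable fun q : ((ℕ × HalfCfg S S G) × (ℕ × HalfCfg S S G)) × (Fin e → ℕ × HalfCfg S S G) =>
      (Fin.cons q.1.1 (Fin.snoc q.2 q.1.2) : Fin (e + 2) → ℕ × HalfCfg S S G) := by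
  refine measurable_pi_lambda _ fun j => ?_
  refine Fin.cases ?_ (fun i => ?_) j
  · simp only [Fin.cons_zero]
    exact measurable_fst.fst
  · simp only [Fin.cons_succ]
    refine Fin.lastCases ?_ (fun i' => ?_) i
    · simp only [Fin.snoc_last]
      exact measurable_fst.snd
    · simp only [Fin.snoc_castSucc]
      exact (measurable_pi_apply i').comp measurable_snd

/-- `halfBlockT` is jointly measurable in `(v₀, x)`. -/
theorem measurable_halfBlockT (hρ : Continuous ρ) {β : ℝ} (hβ : 0 ≤ β) (M : ℝ) {e : ℕ}
    {f : (Fin (e + 1) → HalfCfg S S G) → (Fin (e + 1) → HalfCfg S S G) → ℝ} (hf : Measurable (uncurry f)) :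
    Measurable fun p : (ℕ × HalfCfg S S G) × (ℕ × HalfCfg S S G) => halfBlockT S G Nc ρ β M f p.1 p.2 := by
  haveI := isFiniteMeasure_tMeasure (S := S) (G := G) (Nc := Nc) hβ M
  have h := ((measurable_halfBlock ρ hρ β M hf).comp (measurable_cons_snoc (S := S) (G := G) (e := e))).stronglyMeasurable
  have h' := (h.integral_prod_right' (ν := Measure.pi fun _ : Fin e => tMeasure S G Nc β M)).measurable
  unfold halfBlockT
  simpa only [Function.comp_def] using h'

omit [SecondCountableTopology G] in
/-- `halfBlockT` is bounded. -/
theorem exists_abs_halfBlockT_le {β : ℝ} (hβ : 0 ≤ β) (M : ℝ) {e : ℕ}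
    {f : (Fin (e + 1) → HalfCfg S S G) → (Fin (e + 1) → HalfCfg S S G) → ℝ}
    {C B : ℝ} (hC0 : 0 ≤ C) (hC : ∀ (a b : ℕ × HalfCfg S S G) (Y : HalfCfg S S G), |openLink ρ β M a b Y| ≤ C)
    (hB : ∀ Y X, |f Y X| ≤ B) :
    ∃ CT : ℝ, 0 ≤ CT ∧ ∀ v₀ x : ℕ × HalfCfg S S G, |halfBlockT S G Nc ρ β M f v₀ x| ≤ CT := by
  haveI := isFiniteMeasure_tMeasure (S := S) (G := G) (Nc := Nc) hβ M
  refine ⟨C ^ (e + 1) * B * (Measure.pi fun _ : Fin e => tMeasure S G Nc β M).real Set.univ, ?_, fun v₀ x => ?_⟩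
  · have hB0 : 0 ≤ B := (abs_nonneg _).trans (hB (fun _ _ => 1) (fun _ _ => 1))
    positivity
  · unfold halfBlockT
    have h := norm_integral_le_of_norm_le_const (μ := Measure.pi fun _ : Fin e => tMeasure S G Nc β M)
      (f := fun U : Fin e → ℕ × HalfCfg S S G => halfBlock ρ β M f (Fin.cons v₀ (Fin.snoc U x)))
      (C := C ^ (e + 1) * B) (ae_of_all _ fun U => ?_)
    · rwa [Real.norm_eq_abs] at h
    · rw [Real.norm_eq_abs]
      exact abs_halfBlock_le ρ β M hC0 hC hB _

/-- The block kernel is jointly (strongly) measurable. -/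
theorem stronglyMeasurable_blockKernel (hρ : Continuous ρ) {β : ℝ} (hβ : 0 ≤ β) (M : ℝ) {e : ℕ}
    {f : (Fin (e + 1) → HalfCfg S S G) → (Fin (e + 1) → HalfCfg S S G) → ℝ} (hf : Measurable (uncurry f)) :
    StronglyMeasurable (uncurry (blockKernel S G Nc ρ β M f)) := by
  haveI := isFiniteMeasure_tMeasure (S := S) (G := G) (Nc := Nc) hβ M
  have hT := measurable_halfBlockT (S := S) ρ hρ hβ M hf
  have hA : Measurable fun q : ((ℕ × HalfCfg S S G) × (ℕ × HalfCfg S S G)) × (ℕ × HalfCfg S S G) =>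
      halfBlockT S G Nc ρ β M f q.2 q.1.1 := by
    simpa only [Function.comp_def] using hT.comp (measurable_snd.prodMk measurable_fst.fst)
  have hB : Measurable fun q : ((ℕ × HalfCfg S S G) × (ℕ × HalfCfg S S G)) × (ℕ × HalfCfg S S G) =>
      halfBlockT S G Nc ρ β M f q.2 q.1.2 := by
    simpa only [Function.comp_def] using hT.comp (measurable_snd.prodMk measurable_fst.snd)
  have h1 : Measurable fun q : ((ℕ × HalfCfg S S G) × (ℕ × HalfCfg S S G)) × (ℕ × HalfCfg S S G) =>
      halfBlockT S G Nc ρ β M f q.2 q.1.1 * halfBlockT S G Nc ρ β M f q.2 q.1.2 := hA.mul hB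
  have h := h1.stronglyMeasurable.integral_prod_right' (ν := tMeasure S G Nc β M)
  change StronglyMeasurable fun p : (ℕ × HalfCfg S S G) × (ℕ × HalfCfg S S G) => blockKernel S G Nc ρ β M f p.1 p.2
  unfold blockKernel
  simpa only using h

omit [SecondCountableTopology G] in
/-- The block kernel is bounded. -/
theorem exists_abs_blockKernel_le (hρ : Continuous ρ) {β : ℝ} (hβ : 0 ≤ β) {M : ℝ}
    (hM : ∀ (Y : HalfCfg S S G) (j : Fin (featDim S Nc)), |bondVec ρ Y j| ≤ M) {e : ℕ}
    {f : (Fin (e + 1) → HalfCfg S S G) → (Fin (e + 1) → HalfCfg S S G) → ℝ} {B : ℝ} (hB : ∀ Y X, |f Y X| ≤ B) :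
    ∃ CW : ℝ, ∀ x y : ℕ × HalfCfg S S G, ‖blockKernel S G Nc ρ β M f x y‖ ≤ CW := by
  haveI := isFiniteMeasure_tMeasure (S := S) (G := G) (Nc := Nc) hβ M
  obtain ⟨C, hC0, hC⟩ := exists_abs_openLink_le ρ hρ β hM
  obtain ⟨CT, hCT0, hCT⟩ := exists_abs_halfBlockT_le (S := S) (Nc := Nc) ρ hβ M hC0.le hC hB (e := e)
  refine ⟨CT * CT * (tMeasure S G Nc β M).real Set.univ, fun x y => ?_⟩
  unfold blockKernel
  refine norm_integral_le_of_norm_le_const (ae_of_all _ fun v₀ => ?_)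
  rw [norm_mul, Real.norm_eq_abs, Real.norm_eq_abs]
  exact mul_le_mul (hCT _ _) (hCT _ _) (abs_nonneg _) hCT0

omit [SecondCountableTopology G] in
/-- The block kernel is symmetric. -/
theorem blockKernel_symm (β M : ℝ) {e : ℕ} (f : (Fin (e + 1) → HalfCfg S S G) → (Fin (e + 1) → HalfCfg S S G) → ℝ)
    (x y : ℕ × HalfCfg S S G) : blockKernel S G Nc ρ β M f x y = blockKernel S G Nc ρ β M f y x := by
  unfold blockKernel
  simp_rw [mul_comm (halfBlockT S G Nc ρ β M f _ x)]

end Block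

/-! ## §3 Observables of depth `d = e + 1` read on pair strings, and their swap reflections -/

section Obs

variable {S : ℕ} {G : Type*} {m : ℕ} {e : ℕ}

/-- The observable `f(Y_1…Y_d, X_1…X_d)` read on the pair string `P_t = (Y_t, X_t)`, `t ∈ ℤ/mℤ` (layers `1, …, d`, `d = e+1`). -/
def obsR (f : (Fin (e + 1) → HalfCfg S S G) → (Fin (e + 1) → HalfCfg S S G) → ℝ)
    (P : ZMod m → HalfCfg S S G × HalfCfg S S G) : ℝ :=
  f (fun i => (P (((i : ℕ) + 1 : ℕ) : ZMod m)).1) (fun i => (P (((i : ℕ) + 1 : ℕ) : ZMod m)).2)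

/-- The swap-reflected observable: `f` read on the reflected string `(Θ Y_{1-t}, X_{-t})`, i.e. `f(ΘY_0, ΘY_{-1}, …, ΘY_{1-d}; X_{-1}, …, X_{-d})`. -/
def obsL (f : (Fin (e + 1) → HalfCfg S S G) → (Fin (e + 1) → HalfCfg S S G) → ℝ)
    (P : ZMod m → HalfCfg S S G × HalfCfg S S G) : ℝ :=
  f (fun i => thetaHalf (P (-(((i : ℕ) : ℕ) : ZMod m))).1) (fun i => (P (-((((i : ℕ) + 1 : ℕ)) : ZMod m))).2)

/-- `obsL f P = obsR f (reflectPairs P)` (chain length = torus side): the reflected observable is the observable of the reflected string. -/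
theorem obsR_reflectPairs (f : (Fin (e + 1) → HalfCfg S S G) → (Fin (e + 1) → HalfCfg S S G) → ℝ)
    (P : ZMod S → HalfCfg S S G × HalfCfg S S G) : obsR f (reflectPairs P) = obsL f P := by
  have h1 : ∀ i : Fin (e + 1), (1 : ZMod S) - ((((i : ℕ) + 1 : ℕ)) : ZMod S) = -(((i : ℕ) : ℕ) : ZMod S) := by
    intro i
    push_cast
    ring
  unfold obsR obsL reflectPairs
  simp only [h1]

end Obs

end Summit.QuantumFields.YangMills.Cruxes.DiagonalMirrorRPR.SignTwistedDiagonalTrace.WilsonDiagonal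

end
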